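import Summits.BirchSwinnertonDyer.BirchSwinnertonDyer.Theorems.ResidualThetaTransportAtTwoSignedMuSeedAtTwoPlusTiltLevelEngine
import Summits.BirchSwinnertonDyer.BirchSwinnertonDyer.Theorems.ResidualThetaTransportAtTwoSignedMuSeedAtTwoPlusJetRobertLevelOne
import HarnessLib

/-!
# The `𝔣₀ = 1` Robert function ON THE ENGINE'S OBJECTS: over `𝔽₄ = ℤ₄/(−2)`, with the tree's translation `[g]_f‾ = F̄_U(([w₀]_f‾)⁴, t)`,
# `Σᵢ x(Pᵢ) ≠ 0 ⟹ v(S₀) = 4, v(S₁) = 12` — `NonDeg(1)` in the shape consumed by `Tilt.oddDigit_of_nonDeg_tiltCurve`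
# (seed lines `norm-field-tilt` / `jet-character-sums`; crux `SignedMuSeedAtTwoPlus` stmt-BirchSwinnertonDyer-21438; Kμ⁺ stmt-BirchSwinnertonDyer-20689)

Cell `bsd-wall`, width seat `bsd-wall-rtt-p4-w2` g14 (`--supports`, closes nothing).  THEOREMS ONLY; the lines are NOT registered (W-79);
BSD is not proved by this.

`…JetRobertLevelOne` proved, over any commutative ring of characteristic `2`: for Robert factors `θᵢ·(t + cᵢw) = w` (`θᵢ = 1/(x + cᵢ)`),
`Φ = Σᵢ θᵢ`, `S₀ = λΦ(λt) + λ²Φ(λ²t)` (`λ² + λ + 1 = 0`) and `δ ≡ ū t⁴ (mod t⁸)`: `[t¹²](S₀ + S₀(t + δ)) = p₁²(ū + ū²)`, `p₁ = Σᵢ cᵢ`.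
Here the remaining letters are the ENGINE's (`Tilt.oddDigit_of_nonDeg_tiltCurve`, p676492; `Tilt.levelOne_wall_of_coeff_two_eq_zero`, p681366):
base `𝒪 = ℤ₄ = LubinTate.unitBall ℚ_[2]⟮ζ₃⟯`, `k = 𝒪/(−2)`, the unit `w₀` of `g = 1 − 2w₀` with `w₀, w₀ − 1 ∉ (−2)` (`N(g) = −1`),
`z = [w₀]_f‾`, level step `F̄_U(z⁴, t) = [g]_f‾`, so `ū = z₁⁴ = w̄₀⁴`:

* §1 generic (`k` any commutative ring of characteristic `2`, `z ∈ t·k⟦t⟧` with `z₁² + z₁ + 1 = 0`): `pow_four_eq_self_of_rho`, `rho_pow_four`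
  (`ū = z₁⁴` is again a primitive cube root of `1`), `X_pow_eight_dvd_levelStep_sub` (`t⁸ ∣ (F̄_U(z⁴,t) − t) − z₁⁴t⁴`, `JetCharacterSums.levelStep_delta_dvd`),
  **`coeff_twelve_levelOne_robertSum_levelStep`** (`[t¹²](S₀ + S₀(F̄_U(z⁴, t))) = p₁²`), **`nonDeg_one_robertSum_levelStep`**
  (reduced `k`, `p₁ ≠ 0 ⟹ ord S₀ = 4 ∧ ord(S₀ + S₀(F̄_U(z⁴,t))) = 12`, `12 + 2 < 4²`), stated for any `φ = F̄_U(z⁴, t)` (so that `φ = [g]_f‾` plugs in).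
* §2 on `𝒪 = ℤ₄`, `k = 𝒪/(−2)`: `mk_pow_four_eq` (`ā⁴ = ā`), `two_dvd_sq_add_self_add_one` (`2 ∣ w₀² + w₀ + 1` from the engine's `hw₀`, `hw₀'`:
  `w₀`, `w₀ − 1` units, `ZFour.two_dvd_pow_four_sub_self`), **`mk_sq_add_mk_add_one_eq_zero`** (`w̄₀² + w̄₀ + 1 = 0`), `coeff_one_homBar` (`z₁ = w̄₀`), `rho_coeff_one_homBar`, `homBar_one_sub_two_mul_eq_levelStep` (`[g]_f‾ = F̄_U(z⁴, t)`,
  `Tilt.map_hom_one_add_pow_mul_formalGroupLaw`), and the capstone **`nonDeg_one_robertSum_homBar`**: `p₁ ≠ 0 ⟹ ord S₀ = 4 ∧ ord (S₀ + S₀([g]_f‾ t)) = 12`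
  — the hypotheses `ha₀ : (S m₀).order = a₀`, `hnd : a₀ + 2 < 4^(m₀+1)` of the engine at `m₀ = 1` for the `𝔣₀ = 1` Robert function with any pole set of
  non-zero coordinate sum; in particular for `1/(x + c)`, `c ≠ 0` (the calibration class, `N𝔩 = 3`): the engine table's `(4, 12)` is a theorem.

NOT done here: that the dictionary's `θ̄` IS `∏ᵢ 1/(x + cᵢ)` in these coordinates (S1 (ii)), membership/digits (S1 (iii)), levels `m ≥ 2`.
Design: all algebra is over a generic `k` (rewriting under the `ℤ₄`-quotient types is expensive); §2 only instantiates by `exact`. [folklore]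
-/

set_option autoImplicit false
-- the Theorems namespace of this sub repeats the summit name by design (D-0017 nested layout)
set_option linter.dupNamespace false

noncomputable section

open scoped Classical IntermediateField
open PowerSeries WeierstrassCurve
open Literature.NumberTheory.EllipticCurves
open Literature.NumberTheory.GaloisRepresentations
open Summit.BirchSwinnertonDyer.BirchSwinnertonDyer.Theorems.RelativeLubinTate.ZFour
open Summit.BirchSwinnertonDyer.BirchSwinnertonDyer.Theorems.SignedMuAtTwo.JetCharacterSums

namespace Summit.BirchSwinnertonDyer.BirchSwinnertonDyer.Theorems.SignedMuAtTwo.Tilt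

/-! ## §1 Generic: cube roots of unity, the level step, the capstone over any `k` of characteristic `2` -/

section Rho

variable {R : Type*} [CommRing R]

/-- `a² + a + 1 = 0 ⟹ a⁴ = a` (`a³ = 1`). [folklore] -/
theorem pow_four_eq_self_of_rho {a : R} (ha : a ^ 2 + a + 1 = 0) : a ^ 4 = a := by
  have h3 := pow_three_eq_one_of_rho ha
  linear_combination a * h3

/-- `a² + a + 1 = 0 ⟹ (a⁴)² + a⁴ + 1 = 0`: the fourth power of a primitive cube root of unity is one (the wall unit `ū = z₁⁴ = w̄₀⁴`). [folklore] -/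
theorem rho_pow_four {a : R} (ha : a ^ 2 + a + 1 = 0) : (a ^ 4) ^ 2 + a ^ 4 + 1 = 0 := by
  rw [pow_four_eq_self_of_rho ha]; exact ha

end Rho

section Generic

variable {k : Type*} [CommRing k] [CharP k 2]

/-- `t⁸ ∣ (F̄_U(z⁴, t) − t) − z₁⁴·t⁴` for the tilt curve's level step (`JetCharacterSums.levelStep_delta_dvd` at `n = 2`). [folklore] -/
theorem X_pow_eight_dvd_levelStep_sub {z : k⟦X⟧} (hz0 : constantCoeff z = 0) :
    (X : k⟦X⟧) ^ 8 ∣ (MvPowerSeries.subst ![z ^ 4, (X : k⟦X⟧)] (⟨0, 0, 1, 0, 0⟩ : WeierstrassCurve k).formalGroupLaw - X) -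
      C (coeff 1 z ^ 4) * X ^ 4 := by
  have h := levelStep_delta_dvd hz0 2
  norm_num at h
  rwa [← map_pow] at h

variable {ι : Type*} {s : Finset ι} {c : ι → k} {θ : ι → k⟦X⟧}
  (hθ : ∀ i ∈ s, θ i * (X + C (c i) * (⟨0, 0, 1, 0, 0⟩ : WeierstrassCurve k).formalW) = (⟨0, 0, 1, 0, 0⟩ : WeierstrassCurve k).formalW)
  {l : k} (hl : l ^ 2 + l + 1 = 0) {z : k⟦X⟧} (hz0 : constantCoeff z = 0) (hz1 : coeff 1 z ^ 2 + coeff 1 z + 1 = 0)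
  {φ : k⟦X⟧} (hφ : φ = MvPowerSeries.subst ![z ^ 4, (X : k⟦X⟧)] (⟨0, 0, 1, 0, 0⟩ : WeierstrassCurve k).formalGroupLaw)

include hθ hl hz0 hz1 hφ

/-- **`[t¹²](S₀ + S₀(φ)) = p₁²`** for `φ = F̄_U(z⁴, t)`, `z₁² + z₁ + 1 = 0` (so `ū = z₁⁴` has `ū + ū² = 1`): the `𝔣₀ = 1` Robert sum `Φ = Σᵢ θᵢ`,
`S₀ = λΦ(λt) + λ²Φ(λ²t)`. [folklore] -/
theorem coeff_twelve_levelOne_robertSum_levelStep :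
    coeff 12 ((C l * rescale l (∑ i ∈ s, θ i) + C (l ^ 2) * rescale (l ^ 2) (∑ i ∈ s, θ i)) +
        (C l * rescale l (∑ i ∈ s, θ i) + C (l ^ 2) * rescale (l ^ 2) (∑ i ∈ s, θ i)).subst φ) = (∑ i ∈ s, c i) ^ 2 := by
  subst hφ
  have h := coeff_twelve_levelOne_robertSum_of_rho hθ hl (X_pow_eight_dvd_levelStep_sub hz0) (rho_pow_four hz1)
  rwa [add_sub_cancel] at h

/-- **`NonDeg(1)` for the `𝔣₀ = 1` Robert sum with the level step `φ = F̄_U(z⁴, t)`** (reduced `k`): `p₁ ≠ 0 ⟹ ord S₀ = 4 ∧ ord (S₀ + S₀(φ)) = 12`,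
and `12 + 2 < 4^(1+1)`. [folklore] -/
theorem nonDeg_one_robertSum_levelStep [IsReduced k] (hp : ∑ i ∈ s, c i ≠ 0) :
    PowerSeries.order (C l * rescale l (∑ i ∈ s, θ i) + C (l ^ 2) * rescale (l ^ 2) (∑ i ∈ s, θ i)) = ((4 : ℕ) : ℕ∞) ∧
      PowerSeries.order ((C l * rescale l (∑ i ∈ s, θ i) + C (l ^ 2) * rescale (l ^ 2) (∑ i ∈ s, θ i)) +
        (C l * rescale l (∑ i ∈ s, θ i) + C (l ^ 2) * rescale (l ^ 2) (∑ i ∈ s, θ i)).subst φ : k⟦X⟧) = ((12 : ℕ) : ℕ∞) ∧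
      (12 + 2 < 4 ^ (1 + 1)) := by
  subst hφ
  have h := order_levelOne_robertSum hθ hl (X_pow_eight_dvd_levelStep_sub hz0) (rho_pow_four hz1) hp
  rw [add_sub_cancel] at h
  exact ⟨order_rhoRobertSum hθ hl hp, h, by norm_num⟩

end Generic

/-! ## §2 The engine's residue field `k = ℤ₄/(−2) = 𝔽₄` and its level step `[g]_f‾` -/

section ZFour

variable {ζ : PadicAlgCl 2} (hζ : ζ ^ 2 + ζ + 1 = 0)

include hζ in
/-- `ā⁴ = ā` in `k = 𝒪/(−2)` (`ZFour.two_dvd_pow_four_sub_self`: `2 ∣ a⁴ − a` in `𝒪 = ℤ₄`). [cite: SerreLocalFields1979, Ch. IV §4] -/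
theorem mk_pow_four_eq (a : LubinTate.unitBall (↥ℚ_[2]⟮ζ⟯)) :
    Ideal.Quotient.mk (Ideal.span {-((2 : ℕ) : LubinTate.unitBall (↥ℚ_[2]⟮ζ⟯))}) a ^ 4 =
      Ideal.Quotient.mk (Ideal.span {-((2 : ℕ) : LubinTate.unitBall (↥ℚ_[2]⟮ζ⟯))}) a := by
  have h := two_dvd_pow_four_sub_self hζ a
  rw [← sub_eq_zero, ← map_pow, ← map_sub, Ideal.Quotient.eq_zero_iff_mem, Ideal.mem_span_singleton, neg_dvd]
  exact h

include hζ in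
/-- **`2 ∣ w₀·w₀ + w₀ + 1` in `𝒪 = ℤ₄`** for `w₀ ∉ (−2)`, `w₀ − 1 ∉ (−2)` (the engine's hypotheses `hw₀`, `hw₀'` on `g = 1 − 2w₀`, i.e. `N(g) = −1`):
`2 ∣ w₀⁴ − w₀ = w₀(w₀ − 1)(w₀² + w₀ + 1)` with `w₀`, `w₀ − 1` units of the local ring `𝒪`. [cite: SerreLocalFields1979, Ch. IV §4] -/
theorem two_dvd_sq_add_self_add_one {w₀ : LubinTate.unitBall (↥ℚ_[2]⟮ζ⟯)}
    (hw₀ : w₀ ∉ Ideal.span {-((2 : ℕ) : LubinTate.unitBall (↥ℚ_[2]⟮ζ⟯))})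
    (hw₀' : w₀ + (-1) ∉ Ideal.span {-((2 : ℕ) : LubinTate.unitBall (↥ℚ_[2]⟮ζ⟯))}) :
    ((2 : ℕ) : LubinTate.unitBall (↥ℚ_[2]⟮ζ⟯)) ∣ w₀ * w₀ + w₀ + 1 := by
  have h := two_dvd_pow_four_sub_self hζ w₀
  have hu0 : IsUnit w₀ := by
    have h' := hw₀
    rwa [span_neg_two_eq_maximalIdeal hζ, IsLocalRing.mem_maximalIdeal, mem_nonunits_iff, not_not] at h'
  have hu1 : IsUnit (w₀ + (-1)) := by
    have h' := hw₀'
    rwa [span_neg_two_eq_maximalIdeal hζ, IsLocalRing.mem_maximalIdeal, mem_nonunits_iff, not_not] at h'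
  have e : w₀ ^ (2 ^ 2) - w₀ = w₀ * ((w₀ + (-1)) * (w₀ * w₀ + w₀ + 1)) := by ring
  rw [e] at h
  exact hu1.dvd_mul_left.mp (hu0.dvd_mul_left.mp h)

include hζ in
/-- **`w̄₀² + w̄₀ + 1 = 0` in `k = 𝒪/(−2)`** under the engine's hypotheses on `w₀` (`w̄₀ ∈ 𝔽₄ ∖ 𝔽₂`). [cite: SerreLocalFields1979, Ch. IV §4] -/
theorem mk_sq_add_mk_add_one_eq_zero {w₀ : LubinTate.unitBall (↥ℚ_[2]⟮ζ⟯)}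
    (hw₀ : w₀ ∉ Ideal.span {-((2 : ℕ) : LubinTate.unitBall (↥ℚ_[2]⟮ζ⟯))})
    (hw₀' : w₀ + (-1) ∉ Ideal.span {-((2 : ℕ) : LubinTate.unitBall (↥ℚ_[2]⟮ζ⟯))}) :
    Ideal.Quotient.mk (Ideal.span {-((2 : ℕ) : LubinTate.unitBall (↥ℚ_[2]⟮ζ⟯))}) w₀ ^ 2 +
      Ideal.Quotient.mk (Ideal.span {-((2 : ℕ) : LubinTate.unitBall (↥ℚ_[2]⟮ζ⟯))}) w₀ + 1 = 0 := by
  -- term-mode only: no `rw` under the `ℤ₄`-quotient types (whnf of numerals of `𝒪 ⊂ ℚ₂(ζ₃) ⊂ ℚ̄₂` is prohibitively expensive)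
  have h := two_dvd_sq_add_self_add_one hζ hw₀ hw₀'
  set q := Ideal.Quotient.mk (Ideal.span {-((2 : ℕ) : LubinTate.unitBall (↥ℚ_[2]⟮ζ⟯))}) with hq
  have e : q (w₀ * w₀ + w₀ + 1) = q w₀ * q w₀ + q w₀ + 1 :=
    (map_add q (w₀ * w₀ + w₀) 1).trans
      (congrArg₂ (· + ·) ((map_add q (w₀ * w₀) w₀).trans (congrArg₂ (· + ·) (map_mul q w₀ w₀) rfl)) (map_one q))
  have e' : q w₀ ^ 2 + q w₀ + 1 = q (w₀ * w₀ + w₀ + 1) :=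
    (congrArg₂ (· + ·) (congrArg₂ (· + ·) (sq (q w₀)) rfl) rfl).trans e.symm
  exact e'.trans (Ideal.Quotient.eq_zero_iff_mem.mpr (Ideal.mem_span_singleton.mpr (neg_dvd.mpr h)))

/-- `z₁ = w̄₀`: the linear coefficient of the reduced endomorphism `[w₀]_f‾`. [folklore] -/
theorem coeff_one_homBar (w : LubinTate.unitBall (↥ℚ_[2]⟮ζ⟯)) :
    coeff 1 ((LubinTate.hom (isLTRing_unitBall_adjoin_zeta hζ)
      (isLTSeries_tiltCurve (LubinTate.unitBall (↥ℚ_[2]⟮ζ⟯))) (isLTSeries_tiltCurve (LubinTate.unitBall (↥ℚ_[2]⟮ζ⟯))) w).map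
      (Ideal.Quotient.mk (Ideal.span {-((2 : ℕ) : LubinTate.unitBall (↥ℚ_[2]⟮ζ⟯))}))) =
      Ideal.Quotient.mk (Ideal.span {-((2 : ℕ) : LubinTate.unitBall (↥ℚ_[2]⟮ζ⟯))}) w := by
  rw [coeff_map, LubinTate.coeff_one_hom]

include hζ in
/-- `z₁² + z₁ + 1 = 0` for `z = [w₀]_f‾` under the engine's hypotheses on `w₀`. [folklore] -/
theorem rho_coeff_one_homBar {w₀ : LubinTate.unitBall (↥ℚ_[2]⟮ζ⟯)}
    (hw₀ : w₀ ∉ Ideal.span {-((2 : ℕ) : LubinTate.unitBall (↥ℚ_[2]⟮ζ⟯))})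
    (hw₀' : w₀ + (-1) ∉ Ideal.span {-((2 : ℕ) : LubinTate.unitBall (↥ℚ_[2]⟮ζ⟯))}) :
    coeff 1 ((LubinTate.hom (isLTRing_unitBall_adjoin_zeta hζ)
        (isLTSeries_tiltCurve (LubinTate.unitBall (↥ℚ_[2]⟮ζ⟯))) (isLTSeries_tiltCurve (LubinTate.unitBall (↥ℚ_[2]⟮ζ⟯))) w₀).map
        (Ideal.Quotient.mk (Ideal.span {-((2 : ℕ) : LubinTate.unitBall (↥ℚ_[2]⟮ζ⟯))}))) ^ 2 +
      coeff 1 ((LubinTate.hom (isLTRing_unitBall_adjoin_zeta hζ)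
        (isLTSeries_tiltCurve (LubinTate.unitBall (↥ℚ_[2]⟮ζ⟯))) (isLTSeries_tiltCurve (LubinTate.unitBall (↥ℚ_[2]⟮ζ⟯))) w₀).map
        (Ideal.Quotient.mk (Ideal.span {-((2 : ℕ) : LubinTate.unitBall (↥ℚ_[2]⟮ζ⟯))}))) + 1 = 0 := by
  rw [coeff_one_homBar hζ]
  exact mk_sq_add_mk_add_one_eq_zero hζ hw₀ hw₀'

/-- **The engine's first translation is the level step**: `[g]_f‾ = F̄_U(z⁴, t)` for `g = 1 − 2w₀`, `z = [w₀]_f‾` (`Tilt.map_hom_one_add_pow_mul_formalGroupLaw`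
with `π = −2`, `q = 4`, `j = 1`, `U mod (−2) = ⟨0,0,1,0,0⟩`); so the level-`1` sum `S₀ + S₀([g]_f‾ t)` of the orbit doubling `Z₁ = Z₀·Z₀([g]_f‾ t)` is
`S₀ + S₀(F̄_U(z⁴, t))`. [folklore] -/
theorem homBar_one_sub_two_mul_eq_levelStep (w₀ : LubinTate.unitBall (↥ℚ_[2]⟮ζ⟯)) :
    (LubinTate.hom (isLTRing_unitBall_adjoin_zeta hζ)
        (isLTSeries_tiltCurve (LubinTate.unitBall (↥ℚ_[2]⟮ζ⟯))) (isLTSeries_tiltCurve (LubinTate.unitBall (↥ℚ_[2]⟮ζ⟯)))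
        (1 + -((2 : ℕ) : LubinTate.unitBall (↥ℚ_[2]⟮ζ⟯)) * w₀)).map
      (Ideal.Quotient.mk (Ideal.span {-((2 : ℕ) : LubinTate.unitBall (↥ℚ_[2]⟮ζ⟯))})) =
    MvPowerSeries.subst
      ![((LubinTate.hom (isLTRing_unitBall_adjoin_zeta hζ)
          (isLTSeries_tiltCurve (LubinTate.unitBall (↥ℚ_[2]⟮ζ⟯))) (isLTSeries_tiltCurve (LubinTate.unitBall (↥ℚ_[2]⟮ζ⟯))) w₀).map
          (Ideal.Quotient.mk (Ideal.span {-((2 : ℕ) : LubinTate.unitBall (↥ℚ_[2]⟮ζ⟯))}))) ^ 4,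
        (X : PowerSeries (LubinTate.unitBall (↥ℚ_[2]⟮ζ⟯) ⧸ Ideal.span {-((2 : ℕ) : LubinTate.unitBall (↥ℚ_[2]⟮ζ⟯))}))]
      ((⟨0, 0, 1, 0, 0⟩ : WeierstrassCurve (LubinTate.unitBall (↥ℚ_[2]⟮ζ⟯) ⧸
        Ideal.span {-((2 : ℕ) : LubinTate.unitBall (↥ℚ_[2]⟮ζ⟯))})).formalGroupLaw) := by
  have h := map_hom_one_add_pow_mul_formalGroupLaw (isLTRing_unitBall_adjoin_zeta hζ)
    (isLTSeries_tiltCurve (LubinTate.unitBall (↥ℚ_[2]⟮ζ⟯))) ⟨0, 0, 1, 0, 0⟩ (formalGroupLaw_tiltCurve_zFour_eq_ltF hζ) 1 w₀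
  -- `1 + π¹·w₀ = 1 − 2w₀` on the left, `(U mod (−2)) = ⟨0,0,1,0,0⟩` and `z^{(2²)¹} = z⁴` on the right, by `congrArg` (no rewriting under the
  -- `ℤ₄`-quotient types)
  have e1 : (1 : LubinTate.unitBall (↥ℚ_[2]⟮ζ⟯)) + (-((2 : ℕ) : LubinTate.unitBall (↥ℚ_[2]⟮ζ⟯))) ^ 1 * w₀ =
      1 + -((2 : ℕ) : LubinTate.unitBall (↥ℚ_[2]⟮ζ⟯)) * w₀ := by rw [pow_one]
  have e2 := congrArg (fun a => (LubinTate.hom (isLTRing_unitBall_adjoin_zeta hζ)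
    (isLTSeries_tiltCurve (LubinTate.unitBall (↥ℚ_[2]⟮ζ⟯))) (isLTSeries_tiltCurve (LubinTate.unitBall (↥ℚ_[2]⟮ζ⟯))) a).map
      (Ideal.Quotient.mk (Ideal.span {-((2 : ℕ) : LubinTate.unitBall (↥ℚ_[2]⟮ζ⟯))}))) e1
  have hF : ((⟨0, 0, 1, 0, 0⟩ : WeierstrassCurve (LubinTate.unitBall (↥ℚ_[2]⟮ζ⟯))).map
      (Ideal.Quotient.mk (Ideal.span {-((2 : ℕ) : LubinTate.unitBall (↥ℚ_[2]⟮ζ⟯))}))).formalGroupLaw =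
      (⟨0, 0, 1, 0, 0⟩ : WeierstrassCurve (LubinTate.unitBall (↥ℚ_[2]⟮ζ⟯) ⧸
        Ideal.span {-((2 : ℕ) : LubinTate.unitBall (↥ℚ_[2]⟮ζ⟯))})).formalGroupLaw :=
    congrArg WeierstrassCurve.formalGroupLaw (map_tiltCurve _)
  have hv : ![((LubinTate.hom (isLTRing_unitBall_adjoin_zeta hζ)
          (isLTSeries_tiltCurve (LubinTate.unitBall (↥ℚ_[2]⟮ζ⟯))) (isLTSeries_tiltCurve (LubinTate.unitBall (↥ℚ_[2]⟮ζ⟯))) w₀).map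
          (Ideal.Quotient.mk (Ideal.span {-((2 : ℕ) : LubinTate.unitBall (↥ℚ_[2]⟮ζ⟯))}))) ^ (2 ^ 2) ^ 1,
        (X : PowerSeries (LubinTate.unitBall (↥ℚ_[2]⟮ζ⟯) ⧸ Ideal.span {-((2 : ℕ) : LubinTate.unitBall (↥ℚ_[2]⟮ζ⟯))}))] =
      ![((LubinTate.hom (isLTRing_unitBall_adjoin_zeta hζ)
          (isLTSeries_tiltCurve (LubinTate.unitBall (↥ℚ_[2]⟮ζ⟯))) (isLTSeries_tiltCurve (LubinTate.unitBall (↥ℚ_[2]⟮ζ⟯))) w₀).map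
          (Ideal.Quotient.mk (Ideal.span {-((2 : ℕ) : LubinTate.unitBall (↥ℚ_[2]⟮ζ⟯))}))) ^ 4,
        (X : PowerSeries (LubinTate.unitBall (↥ℚ_[2]⟮ζ⟯) ⧸ Ideal.span {-((2 : ℕ) : LubinTate.unitBall (↥ℚ_[2]⟮ζ⟯))}))] := by
    rw [show ((2 : ℕ) ^ 2) ^ 1 = 4 by norm_num]
  exact e2.symm.trans (h.trans (congrArg₂ (fun v F => MvPowerSeries.subst v F) hv hF))

variable {ι : Type*} {s : Finset ι}
  {c : ι → LubinTate.unitBall (↥ℚ_[2]⟮ζ⟯) ⧸ Ideal.span {-((2 : ℕ) : LubinTate.unitBall (↥ℚ_[2]⟮ζ⟯))}}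
  {θ : ι → PowerSeries (LubinTate.unitBall (↥ℚ_[2]⟮ζ⟯) ⧸ Ideal.span {-((2 : ℕ) : LubinTate.unitBall (↥ℚ_[2]⟮ζ⟯))})}
  (hθ : ∀ i ∈ s, θ i * (X + C (c i) * (⟨0, 0, 1, 0, 0⟩ : WeierstrassCurve (LubinTate.unitBall (↥ℚ_[2]⟮ζ⟯) ⧸
      Ideal.span {-((2 : ℕ) : LubinTate.unitBall (↥ℚ_[2]⟮ζ⟯))})).formalW) =
    (⟨0, 0, 1, 0, 0⟩ : WeierstrassCurve (LubinTate.unitBall (↥ℚ_[2]⟮ζ⟯) ⧸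
      Ideal.span {-((2 : ℕ) : LubinTate.unitBall (↥ℚ_[2]⟮ζ⟯))})).formalW)
  {l : LubinTate.unitBall (↥ℚ_[2]⟮ζ⟯) ⧸ Ideal.span {-((2 : ℕ) : LubinTate.unitBall (↥ℚ_[2]⟮ζ⟯))}} (hl : l ^ 2 + l + 1 = 0)
  {w₀ : LubinTate.unitBall (↥ℚ_[2]⟮ζ⟯)}
  (hw₀ : w₀ ∉ Ideal.span {-((2 : ℕ) : LubinTate.unitBall (↥ℚ_[2]⟮ζ⟯))})
  (hw₀' : w₀ + (-1) ∉ Ideal.span {-((2 : ℕ) : LubinTate.unitBall (↥ℚ_[2]⟮ζ⟯))})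

include hζ hθ hl hw₀ hw₀'

/-- **`NonDeg(1)` for the `𝔣₀ = 1` Robert function on the engine's objects**: with `S₀ = λΦ(λt) + λ²Φ(λ²t)` the `ρ`-symmetrised Robert sum
`Φ = Σᵢ θᵢ` (`θᵢ(t + cᵢw) = w`) over `k = ℤ₄/(−2)`, `g = 1 − 2w₀` with `w̄₀ ∉ 𝔽₂`, and `S₁ := S₀ + S₀([g]_f‾ t)` (the orbit doubling's level-`1` sum):
**`Σᵢ cᵢ ≠ 0 ⟹ ord S₀ = 4 ∧ ord S₁ = 12`**, `12 + 2 < 4^(1+1)` — the hypotheses `ha₀ : (S m₀).order = a₀`, `hnd : a₀ + 2 < 4^(m₀+1)` of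
`Tilt.oddDigit_of_nonDeg_tiltCurve` at `m₀ = 1`.  In particular the calibration class (`N𝔩 = 3`: one factor `1/(x + c)`, `c ≠ 0`). [folklore] -/
theorem nonDeg_one_robertSum_homBar (hp : ∑ i ∈ s, c i ≠ 0) :
    PowerSeries.order (C l * rescale l (∑ i ∈ s, θ i) + C (l ^ 2) * rescale (l ^ 2) (∑ i ∈ s, θ i)) = ((4 : ℕ) : ℕ∞) ∧
      PowerSeries.order ((C l * rescale l (∑ i ∈ s, θ i) + C (l ^ 2) * rescale (l ^ 2) (∑ i ∈ s, θ i)) +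
        (C l * rescale l (∑ i ∈ s, θ i) + C (l ^ 2) * rescale (l ^ 2) (∑ i ∈ s, θ i)).subst
          ((LubinTate.hom (isLTRing_unitBall_adjoin_zeta hζ)
              (isLTSeries_tiltCurve (LubinTate.unitBall (↥ℚ_[2]⟮ζ⟯))) (isLTSeries_tiltCurve (LubinTate.unitBall (↥ℚ_[2]⟮ζ⟯)))
              (1 + -((2 : ℕ) : LubinTate.unitBall (↥ℚ_[2]⟮ζ⟯)) * w₀)).map
            (Ideal.Quotient.mk (Ideal.span {-((2 : ℕ) : LubinTate.unitBall (↥ℚ_[2]⟮ζ⟯))}))) :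
          PowerSeries (LubinTate.unitBall (↥ℚ_[2]⟮ζ⟯) ⧸ Ideal.span {-((2 : ℕ) : LubinTate.unitBall (↥ℚ_[2]⟮ζ⟯))})) = ((12 : ℕ) : ℕ∞) ∧
      (12 + 2 < 4 ^ (1 + 1)) := by
  haveI := charP_two_quotient_neg_two hζ
  haveI := isDomain_quotient_neg_two hζ
  exact nonDeg_one_robertSum_levelStep hθ hl (constantCoeff_homBar hζ w₀) (rho_coeff_one_homBar hζ hw₀ hw₀')
    (homBar_one_sub_two_mul_eq_levelStep hζ w₀) hp

/-- The same with `[t¹²]S₁ = p₁²` spelled out (no reducedness needed). [folklore] -/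
theorem coeff_twelve_levelOne_robertSum_homBar :
    coeff 12 ((C l * rescale l (∑ i ∈ s, θ i) + C (l ^ 2) * rescale (l ^ 2) (∑ i ∈ s, θ i)) +
        (C l * rescale l (∑ i ∈ s, θ i) + C (l ^ 2) * rescale (l ^ 2) (∑ i ∈ s, θ i)).subst
          ((LubinTate.hom (isLTRing_unitBall_adjoin_zeta hζ)
              (isLTSeries_tiltCurve (LubinTate.unitBall (↥ℚ_[2]⟮ζ⟯))) (isLTSeries_tiltCurve (LubinTate.unitBall (↥ℚ_[2]⟮ζ⟯)))
              (1 + -((2 : ℕ) : LubinTate.unitBall (↥ℚ_[2]⟮ζ⟯)) * w₀)).map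
            (Ideal.Quotient.mk (Ideal.span {-((2 : ℕ) : LubinTate.unitBall (↥ℚ_[2]⟮ζ⟯))})))) = (∑ i ∈ s, c i) ^ 2 := by
  haveI := charP_two_quotient_neg_two hζ
  exact coeff_twelve_levelOne_robertSum_levelStep hθ hl (constantCoeff_homBar hζ w₀) (rho_coeff_one_homBar hζ hw₀ hw₀')
    (homBar_one_sub_two_mul_eq_levelStep hζ w₀)

end ZFour

end Summit.BirchSwinnertonDyer.BirchSwinnertonDyer.Theorems.SignedMuAtTwo.Tilt

end
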